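import Literature.NumberTheory.Automorphic.IrreducibleUnitaryKTypeGrowth
import HarnessLib

/-!
# Counting equivalent blocks in an orthogonal decomposition: at most `dim E(τ) / dim τ` copies of `τ`, hence at most `c · d(τ)` copies for an
# irreducible unitary representation of `U(p,q)` (Deitmar–Echterhoff Thm. 7.3.2; Varadarajan §5.4 Thm. 19)

Topic `NumberTheory/Automorphic`; namespace `Literature.NumberTheory.Automorphic`; theorems only (no definition, no named fact, no instance, no `sorry`).  Cell
`hodgecm-mathlib`, line T1a, road HC to the trace-class letter A5, GLUE between the letter ★ V19 `IrreducibleUnitaryKTypeGrowth` ([Varadarajan1989 §5.4 Thm. 19]: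
`dim E(τ) ≤ c·d(τ)²`, typed with `E(τ) = Representation.homRangeSum`) and the BLOCK currency of ★ `CompactGroupBlockNuclearTraceClass`
(`traceClass_clauses_of_forall_decomposition`: sums over a set `S` of pairwise orthogonal irreducible closed `K`-subrepresentations): the number of members of `S`
unitarily equivalent to a given block `W₀` is at most `dim E(τ₀) / dim W₀`, `τ₀ = ` the representation of `K` on `W₀` — the «fibre bound» that turns a lattice sum over
`K`-types into the block sum `Σ_{W ∈ S} dim W · c_W` (node H4 of the line card).

* `toSubmodule_le_homRangeSum_of_areUnitarilyEquivalent` — `W ≃ W₀ ⇒ W ≤ E(τ₀)` (the range of the `K`-map `W₀ ≃ W ↪ E`);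
* `card_mul_finrank_le_finrank_homRangeSum` — for a finite orthogonal family of members `≃ W₀`: `#s · dim W₀ ≤ dim E(τ₀)`;
* `finite_and_ncard_le_of_finrank_homRangeSum_le` — if `dim E(τ₀) ≤ c · (dim W₀)^{r+1}` then `{W ∈ S | W ≃ W₀}` is finite of size `≤ c · (dim W₀)^r` (the growth
  hypothesis of ★ V22 `ArchIntegratedOperatorNuclearOfKTypeGrowth` has a general exponent);
* `IrreducibleUnitaryKTypeGrowth.exists_ncard_equivalent_le` — for a unitary globalization `ϖ` of an irreducible class of `U(p,q)` and any pairwise orthogonal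
  set `S` of closed `K`-subrepresentations of `ϖ|_K`: `∃ c, ∀ W₀ ∈ S` finite-dimensional and non-zero, `#{W ∈ S | W ≃ W₀} ≤ c · dim W₀`.

## References
* A. Deitmar, S. Echterhoff, *Principles of Harmonic Analysis*, 2nd ed. (2014), Thm. 7.3.2 [DeitmarEchterhoff2014].
* V. S. Varadarajan, *An Introduction to Harmonic Analysis on Semisimple Lie Groups* (1989), §5.4 Thm. 19 (PDF p. 155) [Varadarajan1989].
-/

set_option autoImplicit false

noncomputable section

open scoped InnerProductSpace

namespace Literature.NumberTheory.Automorphic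

section Generic

variable {K : Type*} [Group K] {E : Type*} [NormedAddCommGroup E] [InnerProductSpace ℂ E] [CompleteSpace E]
  {σ : ContRepresentation ℂ K E}

omit [CompleteSpace E] in
/-- A closed subrepresentation unitarily equivalent to `W₀` has the dimension of `W₀` (adapted from ★ `ContRepresentation.finrank_eq_of_areUnitarilyEquivalent`,
`HilbertRepIsotypicMultiplicity`). [cite: DeitmarEchterhoff2014, Thm. 7.3.2] -/
theorem finrank_eq_of_areUnitarilyEquivalent_block {W W₀ : ContRepresentation.ClosedSubrep σ}
    (h : ContRepresentation.AreUnitarilyEquivalent W.toContRep W₀.toContRep) :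
    Module.finrank ℂ W.toSubmodule = Module.finrank ℂ W₀.toSubmodule := by
  obtain ⟨e, -⟩ := h
  exact LinearEquiv.finrank_eq e.toContinuousLinearEquiv.toLinearEquiv

omit [CompleteSpace E] in
/-- … and is finite-dimensional when `W₀` is. [cite: DeitmarEchterhoff2014, Thm. 7.3.2] -/
theorem finiteDimensional_of_areUnitarilyEquivalent_block {W W₀ : ContRepresentation.ClosedSubrep σ} [FiniteDimensional ℂ W₀.toSubmodule]
    (h : ContRepresentation.AreUnitarilyEquivalent W.toContRep W₀.toContRep) : FiniteDimensional ℂ W.toSubmodule := by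
  obtain ⟨e, -⟩ := h
  exact LinearEquiv.finiteDimensional e.toContinuousLinearEquiv.toLinearEquiv.symm

omit [CompleteSpace E] in
/-- **A finite orthogonal family of closed subrepresentations `W ≃ W₀` spans `#s · dim W₀` dimensions** (pairwise orthogonal subspaces are independent; adapted from
★ `ContRepresentation.finrank_biSup_eq_card_mul`, `HilbertRepIsotypicMultiplicity`, with the model `τ` a block `W₀`). [cite: DeitmarEchterhoff2014, Thm. 7.3.2] -/
theorem finrank_biSup_eq_card_mul_block {W₀ : ContRepresentation.ClosedSubrep σ} [FiniteDimensional ℂ W₀.toSubmodule]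
    (s : Finset (ContRepresentation.ClosedSubrep σ))
    (hs : ∀ W ∈ s, ContRepresentation.AreUnitarilyEquivalent W.toContRep W₀.toContRep)
    (ho : (s : Set (ContRepresentation.ClosedSubrep σ)).Pairwise fun W W' => W.toSubmodule ⟂ W'.toSubmodule) :
    FiniteDimensional ℂ (⨆ W ∈ s, W.toSubmodule : Submodule ℂ E) ∧
      Module.finrank ℂ (⨆ W ∈ s, W.toSubmodule : Submodule ℂ E) = s.card * Module.finrank ℂ W₀.toSubmodule := by
  classical
  induction s using Finset.induction_on with
  | empty =>
    have h0 : (⨆ W ∈ (∅ : Finset (ContRepresentation.ClosedSubrep σ)), W.toSubmodule : Submodule ℂ E) = ⊥ := by simp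
    refine ⟨?_, ?_⟩
    · rw [h0]
      infer_instance
    · rw [h0, finrank_bot, Finset.card_empty, zero_mul]
  | insert a s ha ih =>
    obtain ⟨hfin, hrank⟩ := ih (fun W hW => hs W (Finset.mem_insert_of_mem hW)) (ho.mono (by simp))
    haveI := hfin
    haveI : FiniteDimensional ℂ a.toSubmodule :=
      finiteDimensional_of_areUnitarilyEquivalent_block (hs a (Finset.mem_insert_self a s))
    rw [Finset.iSup_insert]
    refine ⟨Submodule.finiteDimensional_sup _ _, ?_⟩
    have horth : a.toSubmodule ⟂ ⨆ W ∈ s, W.toSubmodule := by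
      refine Submodule.isOrtho_iSup_right.mpr fun W => Submodule.isOrtho_iSup_right.mpr fun hW => ?_
      exact ho (Finset.mem_coe.mpr (Finset.mem_insert_self a s))
        (Finset.mem_coe.mpr (Finset.mem_insert_of_mem hW)) (fun h => ha (h ▸ hW))
    have hdisj : a.toSubmodule ⊓ (⨆ W ∈ s, W.toSubmodule) = ⊥ :=
      ((Submodule.orthogonal_disjoint (K := ⨆ W ∈ s, W.toSubmodule)).symm.mono_left horth).eq_bot
    have h := Submodule.finrank_sup_add_finrank_inf_eq a.toSubmodule (⨆ W ∈ s, W.toSubmodule)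
    rw [hdisj, finrank_bot, add_zero, hrank, finrank_eq_of_areUnitarilyEquivalent_block (hs a (Finset.mem_insert_self a s)),
      Finset.card_insert_of_notMem ha] at *
    rw [h]
    ring

/-- In finite dimension a topologically irreducible representation is algebraically irreducible (every subspace is closed; adapted from ★
`isIrreducible_of_isTopIrreducible`, `CompactGroupCharacterProjectionIsotypic`). [cite: DeitmarEchterhoff2014, Lemma 6.1.7] -/
theorem isIrreducible_of_isTopIrreducible_block {V : Type*} [NormedAddCommGroup V] [InnerProductSpace ℂ V] [FiniteDimensional ℂ V]
    (τ : ContRepresentation ℂ K V) (hirr : τ.IsTopIrreducible) : τ.toRepresentation.IsIrreducible := by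
  obtain ⟨hnt, hall⟩ := (ContRepresentation.isTopIrreducible_iff τ).mp hirr
  haveI : Nontrivial (Subrepresentation τ.toRepresentation) :=
    ⟨⟨⊥, ⊤, fun hbt => bot_ne_top (congrArg Subrepresentation.toSubmodule hbt : (⊥ : Submodule ℂ V) = ⊤)⟩⟩
  refine ⟨fun ρ' => ?_⟩
  rcases hall ⟨ρ', ρ'.toSubmodule.closed_of_finiteDimensional⟩ with h | h
  · exact Or.inl (congrArg ContRepresentation.ClosedSubrep.toSubrepresentation h)
  · exact Or.inr (congrArg ContRepresentation.ClosedSubrep.toSubrepresentation h)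

omit [CompleteSpace E] in
/-- **`W ≃ W₀ ⇒ W ≤ E(τ₀)`**: a closed subrepresentation unitarily equivalent to the block `W₀` lies in the `τ₀`-part `homRangeSum σ τ₀` of `σ`, `τ₀` the representation
of `K` on `W₀` — it is the range of the `K`-map `W₀ ≃ W ↪ E`. [cite: DeitmarEchterhoff2014, Thm. 7.3.2] -/
theorem toSubmodule_le_homRangeSum_of_areUnitarilyEquivalent {W W₀ : ContRepresentation.ClosedSubrep σ}
    (h : ContRepresentation.AreUnitarilyEquivalent W.toContRep W₀.toContRep) :
    W.toSubmodule ≤ Representation.homRangeSum σ.toRepresentation W₀.toContRep.toRepresentation := by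
  obtain ⟨e, -⟩ := h
  -- the `K`-map `j : W₀ → E`, `j = ι_W ∘ e⁻¹`
  let u : W₀.toSubmodule →L[ℂ] W.toSubmodule := e.symm.toContinuousLinearEquiv.toContinuousLinearMap
  let f : W₀.toSubmodule →ₗ[ℂ] E := W.toSubmodule.subtype ∘ₗ u.toLinearMap
  have h1 : ∀ (k : K) (v : W₀.toSubmodule), u (W₀.toContRep k v) = W.toContRep k (u v) := fun k v =>
    DFunLike.congr_fun (e.symm.isIntertwining k) v
  have hf : ∀ (k : K) (v : W₀.toSubmodule), f ((W₀.toContRep.toRepresentation) k v) = (σ.toRepresentation) k (f v) := by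
    intro k v
    change ((u (W₀.toContRep k v) : W.toSubmodule) : E) = σ k ((u v : W.toSubmodule) : E)
    rw [h1, ContRepresentation.ClosedSubrep.coe_toContRep_apply]
  let j : (W₀.toContRep.toRepresentation).IntertwiningMap (σ.toRepresentation) :=
    LinearMap.intertwiningMap_of_isIntertwiningMap _ _ f hf
  have hrange : LinearMap.range j.toLinearMap = W.toSubmodule := by
    change LinearMap.range f = W.toSubmodule
    have hu : LinearMap.range u.toLinearMap = ⊤ := LinearMap.range_eq_top.2 e.symm.toContinuousLinearEquiv.surjective
    rw [LinearMap.range_comp, hu, Submodule.map_top, Submodule.range_subtype]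
  rw [← hrange]
  exact Representation.range_le_homRangeSum j

omit [CompleteSpace E] in
/-- **`#s · dim W₀ ≤ dim E(τ₀)`** for a finite pairwise orthogonal family `s` of closed subrepresentations each unitarily equivalent to the finite-dimensional block `W₀`
(they span `#s · dim W₀` dimensions inside `E(τ₀)`). [cite: DeitmarEchterhoff2014, Thm. 7.3.2] -/
theorem card_mul_finrank_le_finrank_homRangeSum {W₀ : ContRepresentation.ClosedSubrep σ} [FiniteDimensional ℂ W₀.toSubmodule]
    [FiniteDimensional ℂ (Representation.homRangeSum σ.toRepresentation W₀.toContRep.toRepresentation)]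
    (s : Finset (ContRepresentation.ClosedSubrep σ))
    (hs : ∀ W ∈ s, ContRepresentation.AreUnitarilyEquivalent W.toContRep W₀.toContRep)
    (ho : (s : Set (ContRepresentation.ClosedSubrep σ)).Pairwise fun W W' => W.toSubmodule ⟂ W'.toSubmodule) :
    s.card * Module.finrank ℂ W₀.toSubmodule ≤
      Module.finrank ℂ (Representation.homRangeSum σ.toRepresentation W₀.toContRep.toRepresentation) := by
  rw [← (finrank_biSup_eq_card_mul_block s hs ho).2]
  exact Submodule.finrank_mono (iSup₂_le fun W hW => toSubmodule_le_homRangeSum_of_areUnitarilyEquivalent (hs W hW))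

omit [CompleteSpace E] in
/-- **THE FIBRE BOUND**: if `dim E(τ₀) ≤ c · (dim W₀)^{r+1}` for a non-zero finite-dimensional block `W₀`, then in any pairwise orthogonal set `S` of closed subrepresentations
the members unitarily equivalent to `W₀` are finitely many, at most `c · (dim W₀)^r`. [cite: DeitmarEchterhoff2014, Thm. 7.3.2] [cite: Varadarajan1989, §5.4 Thm. 19] -/
theorem finite_and_ncard_le_of_finrank_homRangeSum_le {S : Set (ContRepresentation.ClosedSubrep σ)}
    (horth : S.Pairwise fun W W' => W.toSubmodule ⟂ W'.toSubmodule)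
    {W₀ : ContRepresentation.ClosedSubrep σ} [FiniteDimensional ℂ W₀.toSubmodule] (h0 : W₀.toSubmodule ≠ ⊥)
    [FiniteDimensional ℂ (Representation.homRangeSum σ.toRepresentation W₀.toContRep.toRepresentation)] {c : ℝ} {r : ℕ}
    (hc : (Module.finrank ℂ (Representation.homRangeSum σ.toRepresentation W₀.toContRep.toRepresentation) : ℝ) ≤
      c * (Module.finrank ℂ W₀.toSubmodule : ℝ) ^ (r + 1)) :
    {W ∈ S | ContRepresentation.AreUnitarilyEquivalent W.toContRep W₀.toContRep}.Finite ∧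
      (({W ∈ S | ContRepresentation.AreUnitarilyEquivalent W.toContRep W₀.toContRep}.ncard : ℕ) : ℝ) ≤
        c * (Module.finrank ℂ W₀.toSubmodule : ℝ) ^ r := by
  set F : Set (ContRepresentation.ClosedSubrep σ) := {W ∈ S | ContRepresentation.AreUnitarilyEquivalent W.toContRep W₀.toContRep} with hF
  have hd : 0 < (Module.finrank ℂ W₀.toSubmodule : ℝ) := by
    have : 0 < Module.finrank ℂ W₀.toSubmodule := Module.finrank_pos_iff.2 (Submodule.nontrivial_iff_ne_bot.2 h0)
    exact_mod_cast this
  -- every finite subfamily of `F` has at most `c · (dim W₀)^r` members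
  have hbound : ∀ s : Finset (ContRepresentation.ClosedSubrep σ), ↑s ⊆ F →
      (s.card : ℝ) ≤ c * (Module.finrank ℂ W₀.toSubmodule : ℝ) ^ r := by
    intro s hsF
    have h1 := card_mul_finrank_le_finrank_homRangeSum (W₀ := W₀) s (fun W hW => (hsF (Finset.mem_coe.2 hW)).2)
      (horth.mono fun W hW => (hsF hW).1)
    have h2 : (s.card : ℝ) * (Module.finrank ℂ W₀.toSubmodule : ℝ) ≤
        c * (Module.finrank ℂ W₀.toSubmodule : ℝ) ^ r * (Module.finrank ℂ W₀.toSubmodule : ℝ) := by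
      have h1' : ((s.card * Module.finrank ℂ W₀.toSubmodule : ℕ) : ℝ) ≤
          (Module.finrank ℂ (Representation.homRangeSum σ.toRepresentation W₀.toContRep.toRepresentation) : ℝ) := by exact_mod_cast h1
      push_cast at h1'
      rw [mul_assoc, ← pow_succ]
      exact h1'.trans hc
    exact le_of_mul_le_mul_right h2 hd
  have hfin : F.Finite := by
    by_contra hinf
    obtain ⟨s, hsF, hcard⟩ := Set.Infinite.exists_subset_card_eq hinf (⌊c * (Module.finrank ℂ W₀.toSubmodule : ℝ) ^ r⌋₊ + 1)
    have h := hbound s hsF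
    rw [hcard] at h
    have := Nat.lt_floor_add_one (c * (Module.finrank ℂ W₀.toSubmodule : ℝ) ^ r)
    push_cast at h
    linarith
  refine ⟨hfin, ?_⟩
  have h := hbound hfin.toFinset (by simp [hF])
  rwa [← Set.ncard_eq_toFinset_card F hfin] at h

end Generic

/-! ## The `U(p,q)` corollary through the letter V19 -/

section UnitaryGroup

open Literature.RepresentationTheory.KonnoKonno2007 Literature.RepresentationTheory.KonnoKonno2007.RealDualPair

/-- **FIBRE BOUND FOR IRREDUCIBLE UNITARY REPRESENTATIONS OF `U(p,q)`** (through the letter ★ `IrreducibleUnitaryKTypeGrowth` [Varadarajan1989 §5.4 Thm. 19]): for a unitary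
globalization `ϖ` of an irreducible `(𝔤, K)`-class and ANY pairwise orthogonal set `S` of closed `K`-subrepresentations of `ϖ|_K`, there is `c` such that every
topologically irreducible finite-dimensional member `W₀ ∈ S` has at most `c · dim W₀` unitarily equivalent companions in `S`.
[cite: Varadarajan1989, §5.4 Thm. 19] [cite: DeitmarEchterhoff2014, Thm. 7.3.2] -/
theorem IrreducibleUnitaryKTypeGrowth.exists_ncard_equivalent_le (h19 : IrreducibleUnitaryKTypeGrowth)
    {α β : Type} [Fintype α] [DecidableEq α] [Fintype β] [DecidableEq β]
    (x : GKIrrClass (uFormGroup α β))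
    {E : Type} [NormedAddCommGroup E] [InnerProductSpace ℂ E] [CompleteSpace E]
    {ϖ : ContRepresentation ℂ (uFormGroup α β).carrier E} (hϖ : IsUnitaryGlobalization (uFormGroup α β) x ϖ)
    {S : Set (ContRepresentation.ClosedSubrep (ϖ.restrict (Subgroup.inclusion (uFormGroup α β).maximalCompact_le_carrier)))}
    (horth : S.Pairwise fun W W' => W.toSubmodule ⟂ W'.toSubmodule) :
    ∃ c : ℝ, ∀ W₀ ∈ S, W₀.toContRep.IsTopIrreducible → FiniteDimensional ℂ W₀.toSubmodule →
      {W ∈ S | ContRepresentation.AreUnitarilyEquivalent W.toContRep W₀.toContRep}.Finite ∧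
        (({W ∈ S | ContRepresentation.AreUnitarilyEquivalent W.toContRep W₀.toContRep}.ncard : ℕ) : ℝ) ≤
          c * (Module.finrank ℂ W₀.toSubmodule : ℝ) := by
  obtain ⟨c, hc⟩ := h19 α β x E ϖ hϖ
  refine ⟨c, fun W₀ hW₀ hirr hfd => ?_⟩
  haveI := hfd
  have hirr' : W₀.toContRep.toRepresentation.IsIrreducible := isIrreducible_of_isTopIrreducible_block W₀.toContRep hirr
  obtain ⟨hfin, hle⟩ := hc W₀.toSubmodule W₀.toContRep.toRepresentation hirr'
  haveI := hfin
  have h0 : W₀.toSubmodule ≠ ⊥ := by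
    intro hbot
    have hnt : Nontrivial W₀.toSubmodule := ((ContRepresentation.isTopIrreducible_iff _).1 hirr).1
    exact (Submodule.nontrivial_iff_ne_bot.1 hnt) hbot
  have hle' : (Module.finrank ℂ (Representation.homRangeSum
      ((ϖ.restrict (Subgroup.inclusion (uFormGroup α β).maximalCompact_le_carrier)).toRepresentation)
        W₀.toContRep.toRepresentation) : ℝ) ≤ c * (Module.finrank ℂ W₀.toSubmodule : ℝ) ^ (1 + 1) := by
    rw [one_add_one_eq_two]; exact hle
  obtain ⟨hF, hN⟩ := finite_and_ncard_le_of_finrank_homRangeSum_le horth h0 hle'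
  exact ⟨hF, by rwa [pow_one] at hN⟩

end UnitaryGroup

end Literature.NumberTheory.Automorphic

end
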